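import Mathlib
import Summits.ResolutionOfSingularities.ResolutionOfSingularities.Theorems.WildQuotientsWildQuotientResolutionBlowupLocalExit
import Literature.AlgebraicGeometry.Resolution.BlowupsLocal
import Literature.AlgebraicGeometry.Resolution.AffineBlowupUnique
import Literature.AlgebraicGeometry.Resolution.NormalCrossingsLocal
import Literature.AlgebraicGeometry.Resolution.EffectiveResolutionSpreadModel
import Literature.AlgebraicGeometry.RelativeSpec.FiniteGroupQuotientGluing
import Literature.AlgebraicGeometry.RelativeSpec.FiniteGroupQuotientUniversal

/-!
# The «one more blow-up» exit in chart form, and the two-chart glue for glued quotients `X/G`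

Crux stmt-ResolutionOfSingularities-15640 (`WildQuotients.WildQuotientResolution`), line `Sketch`;
programme V3U of CHAIN w45c, row **V3U-E part 2** (res-L1-w45c-stub-3). [OURS · L1 W4.5c] —
generic scheme-level glue, NOT a statement of the manuscript.

* `hasResolution_of_isBlowup_local_of_isOpenImmersion`: the exit
  `BlowupExit.hasResolution_of_isBlowup_local` (p484514) with the two covering opens given as open
  immersions `f : P → Y`, `g : Q → Y` (so that a consumer feeds the charts `O/G ↪ X/G` of a glued
  quotient directly): `f(P) ∪ g(Q) = Y`, `Q` regular, `𝓘.comap g = ⊤`, some blow-up of `P` along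
  `𝓘.comap f` regular ⟹ `Y` has a resolution.
* `hasResolution_of_isBlowup_local'`: the same exit with the ∀-form hypothesis of the V5
  signatures (E1), minus quasi-compactness hypotheses.
* ideal-sheaf bookkeeping: `comap_eq_top_of_disjoint_support` /
  `comap_vanishingIdeal_eq_top_of_disjoint` (a morphism whose image misses `supp 𝓘` / `Z` pulls
  `𝓘` / `𝓘_Z` back to `⊤`), `vanishingIdeal_eq_idealSheaf_of_isRadical` (on `Spec R`,
  `𝓘_{V(I)} = Ĩ` for radical `I`, so its blow-up is `affineBlowup I`); for `𝓘_Z ≠ ⊥` when `Z ≠ Y`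
  use the tree's `CP2008.vanishingIdeal_ne_bot_of_ne_univ`, for `𝓘_Z.comap j = 𝓘_{j⁻¹Z}` the
  tree's `comap_vanishingIdeal_of_isOpenImmersion`.
* glued quotients `X/G` (`ActionOver.glued`, Literature `FiniteGroupQuotientGluing`): two
  `G`-stable opens affine over the base with `O₁ ∪ O₂ = X` give two charts covering `X/G`
  (`opensRange_gluedι_sup_eq_top`); the image in `X/G` of a subset of `X` missing `O₂` misses the
  chart `O₂/G` (`gluedMk_image_disjoint_opensRange`, no stability needed: `π⁻¹(O₂/G) = O₂`); a
  closed subset of the chart `O₁/G` whose image misses `O₂/G` has closed image in `X/G`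
  (`isClosed_image_gluedι`); and the image in `X/G` of a closed `S ⊆ X` with `S ⊆ O₁`,
  `S ∩ O₂ = ∅` is closed (`isClosed_gluedMk_image`, via the closed quotient maps `O → O/G`).
Intended consumer: V3U-F (`Y = V/σ` for the weighted blow-up model `V` of `𝔸ⁿ/J₃`, `O₁` the
`A₁`-cone chart, `O₂` the regular chart, `S` = the singular locus of `V`).
-/

-- single-problem summit: the doubled namespace component `ResolutionOfSingularities` is forced
set_option linter.dupNamespace false

noncomputable section

universe u

open CategoryTheory AlgebraicGeometry TopologicalSpace
open Literature.AlgebraicGeometry.Resolution Literature.AlgebraicGeometry.RelativeSpec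

namespace Summit.ResolutionOfSingularities.ResolutionOfSingularities.Theorems.WildQuotientResolution.BlowupExit

/-! ## Ideal-sheaf bookkeeping -/

/-- A morphism whose image misses the support of an ideal sheaf pulls it back to the unit ideal
sheaf. [folklore] -/
theorem comap_eq_top_of_disjoint_support {X Y : Scheme.{u}} (𝓘 : Y.IdealSheafData) (f : X ⟶ Y)
    (h : Disjoint (Set.range f.base) (𝓘.support : Set Y)) : 𝓘.comap f = ⊤ := by
  rw [← Scheme.IdealSheafData.support_eq_bot_iff, Scheme.IdealSheafData.support_comap]
  ext x
  simp only [Closeds.coe_preimage, Set.mem_preimage, Closeds.coe_bot, Set.mem_empty_iff_false,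
    iff_false]
  exact fun hx => Set.disjoint_left.mp h ⟨x, rfl⟩ hx

-- `𝓘_Z ≠ ⊥` for a proper closed subset `Z ≠ Y` is already in the tree:
-- `Literature.AlgebraicGeometry.CossartPiltant200819.CP2008.vanishingIdeal_ne_bot_of_ne_univ`
-- (Literature/AlgebraicGeometry/CossartPiltant200819/Prop48FundamentalLocus2008.lean) — import it;
-- and `(𝓘_Z).comap j = 𝓘_{j⁻¹ Z}` along an open immersion `j` is
-- `Literature.AlgebraicGeometry.Resolution.comap_vanishingIdeal_of_isOpenImmersion` (NormalCrossingsLocal).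

/-- The ideal sheaf of a closed subset pulls back to the unit ideal sheaf along a morphism whose
image misses it. [folklore] -/
theorem comap_vanishingIdeal_eq_top_of_disjoint {X Y : Scheme.{u}} (Z : Closeds Y) (f : X ⟶ Y)
    (h : Disjoint (Set.range f.base) (Z : Set Y)) :
    (Scheme.IdealSheafData.vanishingIdeal Z).comap f = ⊤ :=
  comap_eq_top_of_disjoint_support _ f (by rwa [Scheme.IdealSheafData.coe_support_vanishingIdeal])

/-- **On `Spec R` the ideal sheaf of the closed subset `V(I)`, `I` radical, is the ideal sheaf
`Ĩ` of `I`** (`affineBlowup.idealSheaf I`, whose blow-up is `affineBlowup I` by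
`affineBlowup.isBlowup`) — so «the blow-up of `Spec R` along `𝓘_{V(I)}`» is the affine blowing
up of `I`. (Tree: `radical_idealSheaf_of_isRadical`, `eq_vanishingIdeal_of_radical`,
`affineBlowup.support_idealSheaf`.) [folklore] -/
theorem vanishingIdeal_eq_idealSheaf_of_isRadical {R : Type} [CommRing R] (I : Ideal R)
    (hI : I.IsRadical) (Z : Closeds (Spec (.of R)))
    (hZ : (Z : Set (Spec (.of R))) = PrimeSpectrum.zeroLocus (I : Set R)) :
    Scheme.IdealSheafData.vanishingIdeal Z = affineBlowup.idealSheaf I := by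
  symm
  apply eq_vanishingIdeal_of_radical (radical_idealSheaf_of_isRadical I hI)
  ext1
  rw [affineBlowup.support_idealSheaf, hZ]

/-! ## The exit in chart form -/

/-- **V3U-E, chart form.** `Y` integral locally Noetherian, `𝓘 ≠ ⊥`; open immersions
`f : P → Y`, `g : Q → Y` with `f(P) ∪ g(Q) = Y`, `Q` regular, `𝓘.comap g = ⊤` (the image of `g`
misses the centre), and SOME blow-up of `P` along `𝓘.comap f` regular ⟹ `Y` has a resolution of
singularities (`hasResolution_of_isBlowup_local` for `U = f(P)`, `W = g(Q)`, transporting along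
`P ≅ f(P)`, `Q ≅ g(Q)` with `IsBlowup.comp_iso`). [cite: GortzWedhorn2020, Prop. 13.91–13.92] -/
theorem hasResolution_of_isBlowup_local_of_isOpenImmersion {Y P Q : Scheme.{u}} [IsIntegral Y]
    [IsLocallyNoetherian Y] (𝓘 : Y.IdealSheafData) (h𝓘 : 𝓘 ≠ ⊥) (f : P ⟶ Y) [IsOpenImmersion f]
    (g : Q ⟶ Y) [IsOpenImmersion g] (hcov : f.opensRange ⊔ g.opensRange = ⊤)
    (hQ : Scheme.IsRegular Q) (h𝓘g : 𝓘.comap g = ⊤)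
    (hP : ∃ (B : Scheme.{u}) (p : B ⟶ P), IsBlowup p (𝓘.comap f) ∧ Scheme.IsRegular B) :
    Scheme.HasResolution Y := by
  refine hasResolution_of_isBlowup_local 𝓘 h𝓘 f.opensRange g.opensRange hcov ?_ ?_ ?_
  · exact Scheme.IsRegular.of_iso g.isoOpensRange.hom hQ
  · rw [← Scheme.Hom.isoOpensRange_inv_comp g, Scheme.IdealSheafData.comap_comp, h𝓘g,
      Scheme.IdealSheafData.comap_top]
  · obtain ⟨B, p, hp, hB⟩ := hP
    refine ⟨B, p ≫ f.isoOpensRange.hom, ?_, hB⟩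
    have h := hp.comp_iso f.isoOpensRange
    rwa [← Scheme.IdealSheafData.comap_comp, Scheme.Hom.isoOpensRange_inv_comp] at h

/-- **E1 in the ∀-form of the V5 signatures** (no quasi-compactness / quasi-separatedness needed):
`Y` integral locally Noetherian, `𝓘 ≠ ⊥`, `U ⊔ W = ⊤`, `W` regular, `𝓘.comap W.ι = ⊤`, and EVERY
blow-up of `U` along `𝓘.comap U.ι` regular ⟹ `Y` has a resolution (a blow-up of `U` exists by
`exists_isBlowup`, so this reduces to the ∃-form `hasResolution_of_isBlowup_local`).
[cite: GortzWedhorn2020, Prop. 13.91–13.92] -/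
theorem hasResolution_of_isBlowup_local' {Y : Scheme.{u}} [IsIntegral Y] [IsLocallyNoetherian Y]
    (𝓘 : Y.IdealSheafData) (h𝓘 : 𝓘 ≠ ⊥) (U W : Y.Opens) (hUW : U ⊔ W = ⊤)
    (hW : Scheme.IsRegular (W : Scheme.{u})) (h𝓘W : 𝓘.comap W.ι = ⊤)
    (hU : ∀ (U' : Scheme.{u}) (πU : U' ⟶ (U : Scheme.{u})), IsBlowup πU (𝓘.comap U.ι) →
      Scheme.IsRegular U') :
    Scheme.HasResolution Y := by
  obtain ⟨B, p, hp⟩ := exists_isBlowup (U : Scheme.{u}) (𝓘.comap U.ι)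
  exact hasResolution_of_isBlowup_local 𝓘 h𝓘 U W hUW hW h𝓘W ⟨B, p, hp, hU B p hp⟩

/-! ## Two-chart glue for glued quotients `X/G` -/

section Glued

variable {X S : Scheme.{u}} {r : X ⟶ S} {G : Type u} [Group G] [Finite G]
  (ρ : ActionOver r G) [S.IsSeparated] [IsSeparated r]

/-- **Two stable opens covering `X` give two charts covering `X/G`.** [folklore] -/
theorem opensRange_gluedι_sup_eq_top (hcov : ∀ x : X, ∃ O : ρ.StableAffineOpens, x ∈ O.1)
    (O₁ O₂ : ρ.StableAffineOpens) (h : O₁.1 ⊔ O₂.1 = ⊤) :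
    (ρ.gluedι O₁).opensRange ⊔ (ρ.gluedι O₂).opensRange = ⊤ := by
  rw [eq_top_iff]
  rintro z -
  obtain ⟨x, rfl⟩ := ρ.gluedMk_surjective hcov z
  have hx : x ∈ O₁.1 ⊔ O₂.1 := by
    rw [h]
    exact Opens.mem_top x
  rcases Opens.mem_sup.mp hx with hx | hx
  · refine Opens.mem_sup.mpr (Or.inl ?_)
    change x ∈ ρ.gluedMk hcov ⁻¹ᵁ (ρ.gluedι O₁).opensRange
    rw [ρ.preimage_opensRange_gluedι hcov O₁]
    exact hx
  · refine Opens.mem_sup.mpr (Or.inr ?_)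
    change x ∈ ρ.gluedMk hcov ⁻¹ᵁ (ρ.gluedι O₂).opensRange
    rw [ρ.preimage_opensRange_gluedι hcov O₂]
    exact hx

/-- **The image in `X/G` of a subset of `X` missing the stable open `O` misses the chart `O/G`**
(because `π⁻¹(O/G) = O`; no stability of the subset is needed). [folklore] -/
theorem gluedMk_image_disjoint_opensRange (hcov : ∀ x : X, ∃ O : ρ.StableAffineOpens, x ∈ O.1)
    (T : Set X) (O : ρ.StableAffineOpens)
    (hT : Disjoint T (O.1 : Set X)) :
    Disjoint ((ρ.gluedMk hcov).base '' T) ((ρ.gluedι O).opensRange : Set ρ.glued) := by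
  rw [Set.disjoint_left]
  rintro _ ⟨x, hxT, rfl⟩ hz
  have hx : x ∈ ρ.gluedMk hcov ⁻¹ᵁ (ρ.gluedι O).opensRange := hz
  rw [ρ.preimage_opensRange_gluedι hcov O] at hx
  exact Set.disjoint_left.mp hT hxT hx

/-- **A closed subset of the chart `O₁/G` whose image misses the chart `O₂/G` has closed image in
`X/G`**, when the two charts cover. (Its complement is the union of the open `O₂/G` and the image
of the open complement under the open immersion `O₁/G ↪ X/G`.) [folklore] -/
theorem isClosed_image_gluedι (hcov : ∀ x : X, ∃ O : ρ.StableAffineOpens, x ∈ O.1)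
    (O₁ O₂ : ρ.StableAffineOpens) (h : O₁.1 ⊔ O₂.1 = ⊤)
    (Z₁ : Set (ρ.pieceQuot O₁)) (hZ₁ : IsClosed Z₁)
    (hdisj : Disjoint ((ρ.gluedι O₁).base '' Z₁) ((ρ.gluedι O₂).opensRange : Set ρ.glued)) :
    IsClosed ((ρ.gluedι O₁).base '' Z₁) := by
  have hcovU := opensRange_gluedι_sup_eq_top ρ hcov O₁ O₂ h
  have hinj : Function.Injective (ρ.gluedι O₁).base := (ρ.gluedι O₁).isOpenEmbedding.injective
  have hc : ((ρ.gluedι O₁).base '' Z₁)ᶜ =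
      (ρ.gluedι O₁).base '' Z₁ᶜ ∪ ((ρ.gluedι O₂).opensRange : Set ρ.glued) := by
    ext z
    constructor
    · intro hz
      have hz' : z ∈ (ρ.gluedι O₁).opensRange ⊔ (ρ.gluedι O₂).opensRange := by
        rw [hcovU]
        exact Opens.mem_top z
      rcases Opens.mem_sup.mp hz' with ⟨q, rfl⟩ | h2
      · exact Or.inl ⟨q, fun hq => hz ⟨q, hq, rfl⟩, rfl⟩
      · exact Or.inr h2
    · rintro (⟨q, hq, rfl⟩ | h2) hz
      · obtain ⟨q', hq', e⟩ := hz
        rw [hinj e] at hq'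
        exact hq hq'
      · exact Set.disjoint_right.mp hdisj h2 hz
  rw [← isOpen_compl_iff, hc]
  exact ((ρ.gluedι O₁).isOpenEmbedding.isOpenMap _ hZ₁.isOpen_compl).union
    (ρ.gluedι O₂).opensRange.isOpen

omit [S.IsSeparated] in
/-- **The quotient map `O → O/G` of a piece is a closed map** (it is universally closed,
`ActionOver.universallyClosed_toQuotient`). [cite: MumfordAV1970, §7 Thm. p. 66] -/
theorem isClosedMap_pieceMk (O : ρ.StableAffineOpens) : IsClosedMap (ρ.pieceMk O).base := by
  haveI : UniversallyClosed (ρ.pieceMk O) := (ρ.restrict O.1 O.2.1).universallyClosed_toQuotient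
  exact (ρ.pieceMk O).isClosedMap

/-- **The image in `X/G` of a closed `S ⊆ X` lying in the stable open `O₁` and missing the
stable open `O₂`, `O₁ ∪ O₂ = X`, is closed in `X/G` and misses the chart `O₂/G`.**
(`π|_{O₁} = (O₁ → O₁/G ↪ X/G)`, the first map closed, then `isClosed_image_gluedι`.) [folklore] -/
theorem isClosed_gluedMk_image (hcov : ∀ x : X, ∃ O : ρ.StableAffineOpens, x ∈ O.1)
    (O₁ O₂ : ρ.StableAffineOpens) (h : O₁.1 ⊔ O₂.1 = ⊤)
    (T : Set X) (hT : IsClosed T) (hT₁ : T ⊆ (O₁.1 : Set X)) (hT₂ : Disjoint T (O₂.1 : Set X)) :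
    IsClosed ((ρ.gluedMk hcov).base '' T) ∧
      Disjoint ((ρ.gluedMk hcov).base '' T) ((ρ.gluedι O₂).opensRange : Set ρ.glued) := by
  have hdisj := gluedMk_image_disjoint_opensRange ρ hcov T O₂ hT₂
  refine ⟨?_, hdisj⟩
  -- `π '' T = (O₁/G ↪ X/G) '' ((O₁ → O₁/G) '' (T ∩ O₁))`
  let T₁ : Set (O₁.1 : Scheme.{u}) := O₁.1.ι.base ⁻¹' T
  have hT₁c : IsClosed T₁ := hT.preimage O₁.1.ι.continuous
  have himg : (ρ.gluedMk hcov).base '' T = (ρ.gluedι O₁).base '' ((ρ.pieceMk O₁).base '' T₁) := by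
    ext z
    constructor
    · rintro ⟨x, hxT, rfl⟩
      refine ⟨(ρ.pieceMk O₁).base ⟨x, hT₁ hxT⟩, ⟨⟨x, hT₁ hxT⟩, ?_, rfl⟩, ?_⟩
      · change (O₁.1.ι.base ⟨x, hT₁ hxT⟩) ∈ T
        exact hxT
      · exact (ρ.gluedMk_apply hcov O₁ ⟨x, hT₁ hxT⟩).symm
    · rintro ⟨_, ⟨x, hx, rfl⟩, rfl⟩
      exact ⟨x.1, hx, ρ.gluedMk_apply hcov O₁ x⟩
  rw [himg]
  refine isClosed_image_gluedι ρ hcov O₁ O₂ h _ (isClosedMap_pieceMk ρ O₁ _ hT₁c) ?_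
  rw [← himg]
  exact hdisj

end Glued

end Summit.ResolutionOfSingularities.ResolutionOfSingularities.Theorems.WildQuotientResolution.BlowupExit

end
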